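import Literature.Analysis.FluidPDE.NSBoundedMildOseenIntegral
import Literature.Analysis.FluidPDE.KochTataruFourierSlice
import Literature.Analysis.FluidPDE.KatoLocalBoundedPicard
import Literature.Analysis.FunctionSpaces.PlancherelL1L2
import Literature.Analysis.FunctionSpaces.MinkowskiIntegral
import Literature.Analysis.FunctionSpaces.HomSobolevInterpolation
import HarnessLib

/-!
# The Oseen–Duhamel term of a bounded field with `L²` slices lies in `Ḣ^σ ∩ L²`, `σ < 1`

Analysis/FluidPDE support file (everything **proved**, no definitions, no named facts) for the
persistence-of-regularity argument behind `rusinSverakRhoMaxPure_le`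
(`RusinSverakRhoMaxPureLe.lean`: the Kato solution from a finite-energy `Ḣ^{1/2}` datum is the
Fujita–Kato solution). It supplies the one genuinely analytic estimate of that argument, the
**smoothing bound for the bilinear Duhamel term** of Oseen's scheme,
`B^ν_0(u,u)(t) = ∫₀ᵗ e^{ν(t-τ)Δ} ℙ∇·(u ⊗ u)(τ) dτ = oseenDuhamel ν 0 u u t`
(`NSBoundedMildOseen.lean`), for a field `u` bounded by `M` on `(0, T) × ℝ^ι` whose slices have
`‖u(τ)‖_{L²} ≤ L`:

`‖B^ν_0(u,u)(t)‖_{Ḣ^σ} ≤ C(ι,σ) ν^{-(1+σ)/2} t^{(1-σ)/2} M L`, `0 ≤ σ < 1`,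

with `B^ν_0(u,u)(t) ∈ Ḣ^σ ∩ L²` (`exists_eHomSobolevSeminorm_oseenDuhamel_le`). This is the
estimate printed in Lemarié-Rieusset 2016, proof of Thm. 7.4, PDF p. 151 — for `σ = 1/2`,
`‖∫₀ᵗ W_{ν(t-s)} * ℙ∇·(u ⊗ u) ds‖_{Ḣ^{1/2}} ≤ C ∫₀ᵗ (ν(t-s))^{-3/4} ‖u ⊗ u‖₂ ds` — combined with
`‖u ⊗ u‖₂ ≤ ‖u‖_∞ ‖u‖₂` (the "one factor in `L^∞`" device of the proof of Thm. 9.11, p. 256).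

## Proof (Fourier side)

1. **Rescaling** (`§ Rescale`): with `ũ(s) = 1_{(0,νt)}(s) 1_{(0,T)}(s/ν) u(s/ν)`,
   `B(ũ,ũ)(νt) = ν B^ν_0(u,u)(t)` (`kochTataruBilinear_rescale_eq_smul_oseenDuhamel`), `ũ` is
   bounded by `M`, jointly measurable, has finite Koch–Tataru norm and `L²` slices bounded by `L`.
2. **Symbol** (`§ FourierSlice`): by the tree's `fourier_inner_kochTataruBilinear_slice`
   (Koch–Tataru 2001, (8), (11)) and Fubini,
   `|𝓕⟪B(w,w)(S), w₀⟫(ξ)| ≤ 2π|ξ||w₀| ∫₀^S e^{-4π²(S-s)|ξ|²} Σ_{k,l} |𝓕(w_k w_l(s))(ξ)| ds`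
   (the Leray symbol has norm `≤ 1`).
3. **Weight** (`§ Weight`): `|ξ|^{1+σ} e^{-4π²(S-s)|ξ|²} ≤ (4π²(S-s))^{-(1+σ)/2}` (`x^a e^{-x} ≤ 1`,
   `0 ≤ a ≤ 1`).
4. **Minkowski and Plancherel** (`§ Sobolev`): `‖|ξ|^σ 𝓕(B)(ξ)‖_{L²_ξ}` is bounded through
   Minkowski's integral inequality in `s` (tree's `eLpNorm_integral_le_lintegral_eLpNorm`) by
   `|ι|³ 2π ∫₀^S (4π²(S-s))^{-(1+σ)/2} Σ ‖𝓕(w_k w_l(s))‖_{L²} ds`, and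
   `‖𝓕(w_k w_l(s))‖₂ = ‖w_k w_l(s)‖₂ ≤ M L` (Plancherel for `L¹ ∩ L²`,
   `FunctionSpaces.eLpNorm_fourierIntegral_eq`), `∫₀^S (S-s)^{-(1+σ)/2} ds = S^{(1-σ)/2} 2/(1-σ)`.

## Mathlib / tree search

Tree: `oseenDuhamel`, `kochTataruBilinear(_eq_oseenDuhamel)`, `kochTataruBilinear_rescale_eq_smul_oseenDuhamel`,
`eKochTataruNorm_lt_top_of_bound_of_eq_zero` (`NSBoundedMildOseenIntegral`),
`fourier_inner_kochTataruBilinear_slice`, `integrable_kochTataruBilinear_slice`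
(`KochTataruFourierSlice`), `norm_leraySymbol_apply_le`, `exists_eLpNorm_oseenDuhamel_le_left`,
`aestronglyMeasurable_oseenDuhamel`, `oseenDuhamel_congr_ae_slices`, `volume_restrict_prod_univ_eq_prod`,
`lintegral_enorm_sq_eq_eLpNorm_sq`, `FunctionSpaces.eLpNorm_fourierIntegral_eq`,
`FunctionSpaces.fourier_toLp_ae_eq_fourierIntegral`, `FunctionSpaces.eLpNorm_integral_le_lintegral_eLpNorm`,
`FunctionSpaces.memHomSobolev_iff`, `memLp_complexify_comp`. Nothing on Sobolev regularity of
`oseenDuhamel` (`lean search 'oseenDuhamel.*Sobolev|HomSobolev.*oseen'`). Mathlib: `integral_prod`,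
`AEStronglyMeasurable.integral_prod_right'`, `MeasureTheory.QuasiMeasurePreserving.prodMap`,
`Real.map_volume_mul_right`, `integral_rpow`, `ContinuousLinearMap.integral_comp_comm`.

## References

* P. G. Lemarié-Rieusset, *The Navier–Stokes Problem in the 21st Century*, CRC Press 2016,
  doi:10.1201/b19556, proof of Thm. 7.4 (PDF p. 151), proof of Thm. 9.11 (PDF p. 256).
  [LemarieRieusset2016]
* H. Koch, D. Tataru, *Well-posedness for the Navier–Stokes equations*, Adv. Math. 157 (2001),
  §2 (8), §3 (11). [KochTataruAdvMath2001]
-/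

noncomputable section

open MeasureTheory Set Function Filter Real
open _root_.Topology
open scoped ENNReal NNReal RealInnerProductSpace FourierTransform

namespace Literature.Analysis.FluidPDE

open UnboundedOperators (heatSymbol)
open FunctionSpaces.EuclideanSpace (complexify)

/-! ### One-dimensional integrals and the elementary weight bound -/

section OneDim

/-- `∫_{(0,a)} (a - s)^{-β} ds = a^{1-β}/(1-β)` as a lower Lebesgue integral (`a > 0`, `β < 1`;
reflection `s ↦ a - s` and the power rule). [folklore] -/
theorem lintegral_Ioo_ofReal_sub_rpow_neg {a β : ℝ} (ha : 0 < a) (hβ : β < 1) :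
    ∫⁻ s in Ioo 0 a, ENNReal.ofReal ((a - s) ^ (-β)) = ENNReal.ofReal (a ^ (1 - β) / (1 - β)) := by
  have hmp : MeasurePreserving (fun s : ℝ => a - s) volume volume :=
    Measure.measurePreserving_sub_left volume a
  have hemb : MeasurableEmbedding (fun s : ℝ => a - s) :=
    (MeasurableEquiv.subLeft a).measurableEmbedding
  have h := hmp.setLIntegral_comp_preimage_emb hemb
    (fun r => ENNReal.ofReal (r ^ (-β))) (Ioo 0 a)
  rw [preimage_const_sub_Ioo, sub_zero, sub_self] at h
  rw [h]
  have he : (-1 : ℝ) < -β := by linarith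
  have hii : IntervalIntegrable (fun r : ℝ => r ^ (-β)) volume 0 a :=
    intervalIntegral.intervalIntegrable_rpow' he
  have hint : IntegrableOn (fun r : ℝ => r ^ (-β)) (Ioo 0 a) := (hii.1).mono_set Ioo_subset_Ioc_self
  have hnn : 0 ≤ᵐ[volume.restrict (Ioo 0 a)] fun r : ℝ => r ^ (-β) :=
    (ae_restrict_mem measurableSet_Ioo).mono fun r hr => Real.rpow_nonneg hr.1.le _
  rw [← ofReal_integral_eq_lintegral_ofReal hint hnn, ← integral_Ioc_eq_integral_Ioo,
    ← intervalIntegral.integral_of_le ha.le, integral_rpow (Or.inl he)]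
  congr 1
  rw [Real.zero_rpow (by linarith), sub_zero, show -β + 1 = 1 - β by ring]

/-- The elementary bound `x^a e^{-x} ≤ 1` for `x ≥ 0`, `0 ≤ a ≤ 1` (`x^a ≤ max(1, x) ≤ e^x`).
[folklore] -/
theorem rpow_mul_exp_neg_le_one {x a : ℝ} (hx : 0 ≤ x) (ha₀ : 0 ≤ a) (ha₁ : a ≤ 1) :
    x ^ a * Real.exp (-x) ≤ 1 := by
  have h1 : x ^ a ≤ max 1 x := by
    rcases le_or_gt x 1 with hx1 | hx1
    · exact (Real.rpow_le_one hx hx1 ha₀).trans (le_max_left _ _)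
    · calc x ^ a ≤ x ^ (1 : ℝ) := Real.rpow_le_rpow_of_exponent_le hx1.le ha₁
        _ = x := Real.rpow_one x
        _ ≤ max 1 x := le_max_right _ _
  have h2 : max 1 x ≤ Real.exp x :=
    max_le (Real.one_le_exp hx) (by linarith [Real.add_one_le_exp x])
  rw [Real.exp_neg, mul_inv_le_iff₀ (Real.exp_pos x), one_mul]
  exact h1.trans h2

/-- **Parabolic weight bound**: for `θ > 0`, `0 ≤ a ≤ 1` and every `ξ` in a normed group,
`‖ξ‖^{2a} e^{-(2π)² θ ‖ξ‖²} ≤ ((2π)² θ)^{-a}` (with `x = (2π)²θ‖ξ‖²`, `x^a e^{-x} ≤ 1`). For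
`a = (1+σ)/2` this is `‖ξ‖^{1+σ} e^{-4π²θ‖ξ‖²} ≤ (4π²θ)^{-(1+σ)/2}`. [folklore] -/
theorem norm_rpow_mul_heatSymbol_le {E : Type*} [NormedAddCommGroup E] {θ : ℝ} (hθ : 0 < θ)
    {a : ℝ} (ha₀ : 0 ≤ a) (ha₁ : a ≤ 1) (ξ : E) :
    ‖ξ‖ ^ (2 * a) * heatSymbol θ ξ ≤ ((2 * π) ^ 2 * θ) ^ (-a) := by
  set c : ℝ := (2 * π) ^ 2 * θ with hc
  have hcpos : 0 < c := by positivity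
  set x : ℝ := c * ‖ξ‖ ^ 2 with hx
  have hx0 : 0 ≤ x := by positivity
  have hsymb : heatSymbol θ ξ = Real.exp (-x) := by
    rw [UnboundedOperators.heatSymbol, hx, hc]
    congr 1
    ring
  have hnorm : ‖ξ‖ ^ (2 * a) = c ^ (-a) * x ^ a := by
    rw [hx, Real.mul_rpow hcpos.le (sq_nonneg _), ← mul_assoc, Real.rpow_neg hcpos.le,
      inv_mul_cancel₀ (Real.rpow_pos_of_pos hcpos a).ne', one_mul, Real.rpow_mul (norm_nonneg _),
      Real.rpow_two]
  rw [hsymb, hnorm, mul_assoc]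
  calc c ^ (-a) * (x ^ a * Real.exp (-x)) ≤ c ^ (-a) * 1 :=
        mul_le_mul_of_nonneg_left (rpow_mul_exp_neg_le_one hx0 ha₀ ha₁) (Real.rpow_nonneg hcpos.le _)
    _ = c ^ (-a) := mul_one _

end OneDim

variable {ι : Type*} [Fintype ι]

/-! ### Tensor slices of a bounded, jointly measurable field with `L²` slices -/

section Tensor

variable {w : ℝ → (EuclideanSpace ℝ ι) → (EuclideanSpace ℝ ι)} {M S : ℝ} {L : ℝ≥0}

/-- Coordinates are bounded by the Euclidean norm: `|v_k| ≤ ‖v‖`. [folklore] -/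
theorem abs_coord_le_euclideanNorm (v : EuclideanSpace ℝ ι) (k : ι) : |v k| ≤ ‖v‖ := by
  simpa using PiLp.norm_apply_le (p := 2) v k

/-- The scalar tensor slice `y ↦ w_k(s,y) w_l(s,y)` of a slice `w(s) ∈ L²` with `‖w(s)‖_{L²} ≤ L`
and `|w| ≤ M` is integrable, square integrable, and `‖w_k w_l(s)‖_{L²} ≤ M L`. [folklore] -/
theorem tensorSlice_integrable_memLp (hM : 0 ≤ M) (hwM : ∀ s y, ‖w s y‖ ≤ M) {s : ℝ}
    (hw2 : MemLp (w s) 2 volume) (hwL : eLpNorm (w s) 2 volume ≤ L) (k l : ι) :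
    Integrable (fun y => (((w s y) k * (w s y) l : ℝ) : ℂ)) ∧
      MemLp (fun y => (((w s y) k * (w s y) l : ℝ) : ℂ)) 2 volume ∧
      eLpNorm (fun y => (((w s y) k * (w s y) l : ℝ) : ℂ)) 2 volume ≤ ENNReal.ofReal M * L := by
  have hmeas : AEStronglyMeasurable (fun y => (((w s y) k * (w s y) l : ℝ) : ℂ)) volume := by
    have hk : AEStronglyMeasurable (fun y => (w s y) k) volume :=
      (EuclideanSpace.proj k).continuous.comp_aestronglyMeasurable hw2.1
    have hl : AEStronglyMeasurable (fun y => (w s y) l) volume :=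
      (EuclideanSpace.proj l).continuous.comp_aestronglyMeasurable hw2.1
    exact Complex.continuous_ofReal.comp_aestronglyMeasurable (hk.mul hl)
  have hptM : ∀ y, ‖(((w s y) k * (w s y) l : ℝ) : ℂ)‖ ≤ ‖(M • w s) y‖ := by
    intro y
    rw [Complex.norm_real, Real.norm_eq_abs, abs_mul, Pi.smul_apply, norm_smul,
      Real.norm_of_nonneg hM]
    exact mul_le_mul ((abs_coord_le_euclideanNorm (w s y) k).trans (hwM s y))
      (abs_coord_le_euclideanNorm (w s y) l) (abs_nonneg _) hM
  have hpt2 : ∀ y, ‖(((w s y) k * (w s y) l : ℝ) : ℂ)‖ ≤ ‖w s y‖ ^ 2 := by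
    intro y
    rw [Complex.norm_real, Real.norm_eq_abs, abs_mul, sq]
    exact mul_le_mul (abs_coord_le_euclideanNorm (w s y) k) (abs_coord_le_euclideanNorm (w s y) l)
      (abs_nonneg _) (norm_nonneg _)
  have hint2 : Integrable (fun y => ‖w s y‖ ^ 2) volume :=
    (memLp_two_iff_integrable_sq_norm hw2.1).1 hw2
  refine ⟨hint2.mono' hmeas (Eventually.of_forall fun y => ?_), ?_, ?_⟩
  · exact hpt2 y
  · exact (hw2.const_smul M).of_le hmeas (Eventually.of_forall hptM)
  · calc eLpNorm (fun y => (((w s y) k * (w s y) l : ℝ) : ℂ)) 2 volume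
        ≤ eLpNorm (M • w s) 2 volume := eLpNorm_mono hptM
      _ = ENNReal.ofReal M * eLpNorm (w s) 2 volume := by
          rw [eLpNorm_const_smul, Real.enorm_eq_ofReal hM]
      _ ≤ ENNReal.ofReal M * L := mul_le_mul' le_rfl hwL

/-- `|𝓕(w_k w_l(s))(ξ)| ≤ ‖w(s)‖²_{L²} ≤ L²`: the Fourier transform is bounded by the `L¹` norm
of the tensor slice, itself at most `∫ |w(s)|²`. [folklore] -/
theorem norm_fourier_tensorSlice_le {s : ℝ} (hw2 : MemLp (w s) 2 volume)
    (hwL : eLpNorm (w s) 2 volume ≤ L) (k l : ι) (ξ : (EuclideanSpace ℝ ι)) :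
    ‖𝓕 (fun y => (((w s y) k * (w s y) l : ℝ) : ℂ)) ξ‖ ≤ (L : ℝ) ^ 2 := by
  have hint2 : Integrable (fun y => ‖w s y‖ ^ 2) volume :=
    (memLp_two_iff_integrable_sq_norm hw2.1).1 hw2
  rw [Real.fourier_eq]
  calc ‖∫ y, 𝐞 (-⟪y, ξ⟫) • (((w s y) k * (w s y) l : ℝ) : ℂ)‖
      ≤ ∫ y, ‖w s y‖ ^ 2 := by
        refine norm_integral_le_of_norm_le hint2 (Eventually.of_forall fun y => ?_)
        rw [Circle.norm_smul, Complex.norm_real, Real.norm_eq_abs, abs_mul, sq]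
        exact mul_le_mul (abs_coord_le_euclideanNorm (w s y) k) (abs_coord_le_euclideanNorm (w s y) l)
          (abs_nonneg _) (norm_nonneg _)
    _ ≤ (L : ℝ) ^ 2 := by
        have h1 : ∫ y, ‖w s y‖ ^ 2 = (∫⁻ y, ‖w s y‖ₑ ^ (2 : ℕ)).toReal := by
          rw [integral_eq_lintegral_of_nonneg_ae (Eventually.of_forall fun y => by positivity)
            hint2.1]
          congr 1
          refine lintegral_congr fun y => ?_
          rw [← ofReal_norm, ENNReal.ofReal_pow (norm_nonneg _)]
        have h2 : ∫⁻ y, ‖w s y‖ₑ ^ (2 : ℕ) = eLpNorm (w s) 2 volume ^ (2 : ℕ) := by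
          rw [eLpNorm_eq_lintegral_rpow_enorm_toReal two_ne_zero ENNReal.ofNat_ne_top]
          simp only [ENNReal.toReal_ofNat, ENNReal.rpow_ofNat, one_div]
          rw [← ENNReal.rpow_natCast (((∫⁻ y, ‖w s y‖ₑ ^ (2 : ℕ)) ^ (2 : ℝ)⁻¹)) 2, ← ENNReal.rpow_mul]
          norm_num
        rw [h1, h2]
        have h3 : eLpNorm (w s) 2 volume ^ (2 : ℕ) ≤ (L : ℝ≥0∞) ^ (2 : ℕ) := by gcongr
        calc (eLpNorm (w s) 2 volume ^ (2 : ℕ)).toReal ≤ ((L : ℝ≥0∞) ^ (2 : ℕ)).toReal :=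
              ENNReal.toReal_mono (ENNReal.pow_ne_top ENNReal.coe_ne_top) h3
          _ = (L : ℝ) ^ 2 := by simp

/-- The tensor slices as a function on `ℝ × ℝ^ι` are jointly a.e. strongly measurable when `w` is.
[folklore] -/
theorem aestronglyMeasurable_tensor
    (hw : AEStronglyMeasurable (uncurry w) (volume : Measure (ℝ × (EuclideanSpace ℝ ι)))) (k l : ι) :
    AEStronglyMeasurable (fun p : ℝ × (EuclideanSpace ℝ ι) => (((w p.1 p.2) k * (w p.1 p.2) l : ℝ) : ℂ))
      (volume : Measure (ℝ × (EuclideanSpace ℝ ι))) := by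
  have hk : AEStronglyMeasurable (fun p : ℝ × (EuclideanSpace ℝ ι) => (w p.1 p.2) k) volume :=
    (EuclideanSpace.proj k).continuous.comp_aestronglyMeasurable hw
  have hl : AEStronglyMeasurable (fun p : ℝ × (EuclideanSpace ℝ ι) => (w p.1 p.2) l) volume :=
    (EuclideanSpace.proj l).continuous.comp_aestronglyMeasurable hw
  exact Complex.continuous_ofReal.comp_aestronglyMeasurable (hk.mul hl)

/-- **Joint measurability of the Fourier transforms of the tensor slices**: for `w` jointly
measurable, `(s, ξ) ↦ 𝓕(w_k w_l(s))(ξ)` is a.e. strongly measurable on `ℝ × ℝ^ι` (the Fourier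
integrand `((s,ξ),y) ↦ e^{-2πi⟨y,ξ⟩} w_k w_l(s,y)` is jointly measurable, the projection
`((s,ξ),y) ↦ (s,y)` being quasi-measure-preserving; Mathlib
`AEStronglyMeasurable.integral_prod_right'`). [folklore] -/
theorem aestronglyMeasurable_fourier_tensor
    (hw : AEStronglyMeasurable (uncurry w) (volume : Measure (ℝ × (EuclideanSpace ℝ ι)))) (k l : ι) :
    AEStronglyMeasurable (fun p : ℝ × (EuclideanSpace ℝ ι) =>
        𝓕 (fun y => (((w p.1 y) k * (w p.1 y) l : ℝ) : ℂ)) p.2)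
      ((volume : Measure ℝ).prod (volume : Measure (EuclideanSpace ℝ ι))) := by
  set G : ℝ × (EuclideanSpace ℝ ι) → ℂ := fun p => (((w p.1 p.2) k * (w p.1 p.2) l : ℝ) : ℂ) with hG
  have hGm : AEStronglyMeasurable G ((volume : Measure ℝ).prod (volume : Measure (EuclideanSpace ℝ ι))) :=
    aestronglyMeasurable_tensor hw k l
  have hπ : Measure.QuasiMeasurePreserving (Prod.map Prod.fst id : (ℝ × (EuclideanSpace ℝ ι)) × (EuclideanSpace ℝ ι) → ℝ × (EuclideanSpace ℝ ι))
      (((volume : Measure ℝ).prod (volume : Measure (EuclideanSpace ℝ ι))).prod (volume : Measure (EuclideanSpace ℝ ι)))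
      ((volume : Measure ℝ).prod (volume : Measure (EuclideanSpace ℝ ι))) :=
    MeasureTheory.QuasiMeasurePreserving.prodMap Measure.quasiMeasurePreserving_fst
      (Measure.QuasiMeasurePreserving.id _)
  have hH : AEStronglyMeasurable
      (fun q : (ℝ × (EuclideanSpace ℝ ι)) × (EuclideanSpace ℝ ι) =>
        𝐞 (-⟪q.2, q.1.2⟫) • G (Prod.map Prod.fst id q))
      (((volume : Measure ℝ).prod (volume : Measure (EuclideanSpace ℝ ι))).prod
        (volume : Measure (EuclideanSpace ℝ ι))) := by
    have hchar : Continuous fun q : (ℝ × (EuclideanSpace ℝ ι)) × (EuclideanSpace ℝ ι) =>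
        𝐞 (-⟪q.2, q.1.2⟫) := Real.continuous_fourierChar.comp (by fun_prop)
    exact hchar.aestronglyMeasurable.smul (hGm.comp_quasiMeasurePreserving hπ)
  refine (hH.integral_prod_right').congr (Eventually.of_forall fun p => ?_)
  simp only [Real.fourier_eq, hG, Prod.map_apply, id_eq]

/-- For each frequency `ξ`, `s ↦ 𝓕(w_k w_l(s))(ξ)` is a.e. strongly measurable. [folklore] -/
theorem aestronglyMeasurable_fourier_tensor_left
    (hw : AEStronglyMeasurable (uncurry w) (volume : Measure (ℝ × (EuclideanSpace ℝ ι)))) (k l : ι) (ξ : (EuclideanSpace ℝ ι)) :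
    AEStronglyMeasurable (fun s : ℝ => 𝓕 (fun y => (((w s y) k * (w s y) l : ℝ) : ℂ)) ξ)
      (volume : Measure ℝ) := by
  set G : ℝ × (EuclideanSpace ℝ ι) → ℂ := fun p => (((w p.1 p.2) k * (w p.1 p.2) l : ℝ) : ℂ) with hG
  have hGm : AEStronglyMeasurable G ((volume : Measure ℝ).prod (volume : Measure (EuclideanSpace ℝ ι))) :=
    aestronglyMeasurable_tensor hw k l
  have hchar : Continuous fun q : ℝ × (EuclideanSpace ℝ ι) => 𝐞 (-⟪q.2, ξ⟫) :=
    Real.continuous_fourierChar.comp (by fun_prop)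
  have hH : AEStronglyMeasurable (fun q : ℝ × (EuclideanSpace ℝ ι) => 𝐞 (-⟪q.2, ξ⟫) • G q)
      ((volume : Measure ℝ).prod (volume : Measure (EuclideanSpace ℝ ι))) :=
    hchar.aestronglyMeasurable.smul hGm
  refine (hH.integral_prod_right').congr (Eventually.of_forall fun s => ?_)
  simp only [Real.fourier_eq, hG]

/-- Linearity of the Fourier integral over finite sums with constant coefficients, for
integrable summands. [folklore] -/
theorem fourier_finset_sum_const_mul {κ : Type*} (T : Finset κ) {f : κ → (EuclideanSpace ℝ ι) → ℂ}
    (hf : ∀ i ∈ T, Integrable (f i)) (c : κ → ℂ) (ξ : (EuclideanSpace ℝ ι)) :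
    𝓕 (fun y => ∑ i ∈ T, c i * f i y) ξ = ∑ i ∈ T, c i * 𝓕 (f i) ξ := by
  simp only [Real.fourier_eq]
  have hint : ∀ i ∈ T, Integrable (fun y : (EuclideanSpace ℝ ι) => 𝐞 (-⟪y, ξ⟫) • (c i * f i y)) :=
    fun i hi => (Real.fourierIntegral_convergent_iff ξ).2 ((hf i hi).const_mul (c i))
  calc ∫ y, 𝐞 (-⟪y, ξ⟫) • ∑ i ∈ T, c i * f i y
      = ∫ y, ∑ i ∈ T, 𝐞 (-⟪y, ξ⟫) • (c i * f i y) := by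
        refine integral_congr_ae (Eventually.of_forall fun y => ?_)
        simp only [Finset.smul_sum]
    _ = ∑ i ∈ T, ∫ y, 𝐞 (-⟪y, ξ⟫) • (c i * f i y) := integral_finsetSum T hint
    _ = ∑ i ∈ T, c i * ∫ y, 𝐞 (-⟪y, ξ⟫) • f i y := by
        refine Finset.sum_congr rfl fun i _ => ?_
        rw [← integral_const_mul]
        refine integral_congr_ae (Eventually.of_forall fun y => ?_)
        simp only [Circle.smul_def, smul_eq_mul]
        ring

end Tensor

/-! ### The Fourier transform of a tested slice of `B(w, w)` and its pointwise bound -/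

section FourierSlice

variable {w : ℝ → (EuclideanSpace ℝ ι) → (EuclideanSpace ℝ ι)} {M S : ℝ} {L : ℝ≥0}

/-- `∫_{(0,S)×ℝ^ι} |w|² ≤ |(0,S)| L²` and the `L¹`-majorant of `fourier_inner_kochTataruBilinear_slice`,
`∫_{(0,S)×ℝ^ι} (S-s)^{-1/2} |w|² ≤ 2√S L² < ∞`, for a jointly measurable field with `L²` slices
bounded by `L`. [folklore] -/
theorem lintegral_weight_enorm_mul_enorm_lt_top
    (hw : AEStronglyMeasurable (uncurry w) (volume : Measure (ℝ × (EuclideanSpace ℝ ι)))) (hS : 0 < S)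
    (hw2 : ∀ s ∈ Ioo 0 S, MemLp (w s) 2 volume ∧ eLpNorm (w s) 2 volume ≤ L) :
    (∫⁻ p, ‖w p.1 p.2‖ₑ ^ 2 ∂((volume.restrict (Ioo 0 S)).prod (volume : Measure (EuclideanSpace ℝ ι))) ≤
        (L : ℝ≥0∞) ^ 2 * volume (Ioo 0 S)) ∧
      ∫⁻ p in Ioo 0 S ×ˢ univ, ENNReal.ofReal ((S - p.1) ^ (-(1 / 2 : ℝ))) *
        (‖w p.1 p.2‖ₑ * ‖w p.1 p.2‖ₑ) ∂(volume : Measure (ℝ × (EuclideanSpace ℝ ι))) < ∞ := by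
  have hwm : AEMeasurable (fun p : ℝ × (EuclideanSpace ℝ ι) => ‖w p.1 p.2‖ₑ)
      ((volume.restrict (Ioo 0 S)).prod (volume : Measure (EuclideanSpace ℝ ι))) := by
    have := (hw.mono_measure (Measure.restrict_le_self (s := Ioo 0 S ×ˢ univ))).enorm
    rw [volume_restrict_prod_univ_eq_prod] at this
    exact this
  have hsl : ∀ s ∈ Ioo 0 S, ∫⁻ y, ‖w s y‖ₑ ^ 2 ≤ (L : ℝ≥0∞) ^ 2 := fun s hs => by
    have h2 : ∫⁻ y, ‖w s y‖ₑ ^ (2 : ℕ) = eLpNorm (w s) 2 volume ^ (2 : ℕ) := by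
      rw [eLpNorm_eq_lintegral_rpow_enorm_toReal two_ne_zero ENNReal.ofNat_ne_top]
      simp only [ENNReal.toReal_ofNat, ENNReal.rpow_ofNat, one_div]
      rw [← ENNReal.rpow_natCast (((∫⁻ y, ‖w s y‖ₑ ^ (2 : ℕ)) ^ (2 : ℝ)⁻¹)) 2, ← ENNReal.rpow_mul]
      norm_num
    rw [h2]
    gcongr
    exact (hw2 s hs).2
  constructor
  · rw [lintegral_prod _ (hwm.pow_const _)]
    calc ∫⁻ s in Ioo 0 S, ∫⁻ y, ‖w s y‖ₑ ^ 2 ≤ ∫⁻ s in Ioo 0 S, (L : ℝ≥0∞) ^ 2 :=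
          setLIntegral_mono' measurableSet_Ioo hsl
      _ = (L : ℝ≥0∞) ^ 2 * volume (Ioo 0 S) := setLIntegral_const _ _
  · have hfm : AEMeasurable (fun p : ℝ × (EuclideanSpace ℝ ι) => ENNReal.ofReal ((S - p.1) ^ (-(1 / 2 : ℝ))) *
        (‖w p.1 p.2‖ₑ * ‖w p.1 p.2‖ₑ)) ((volume.restrict (Ioo 0 S)).prod (volume : Measure (EuclideanSpace ℝ ι))) := by
      refine AEMeasurable.mul ?_ (hwm.mul hwm)
      exact (Measurable.ennreal_ofReal ((measurable_const.sub measurable_fst).pow_const _)).aemeasurable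
    rw [volume_restrict_prod_univ_eq_prod, lintegral_prod _ hfm]
    have hslice : ∀ s ∈ Ioo 0 S, ∫⁻ y, ENNReal.ofReal ((S - s) ^ (-(1 / 2 : ℝ))) *
        (‖w s y‖ₑ * ‖w s y‖ₑ) ≤ ENNReal.ofReal ((S - s) ^ (-(1 / 2 : ℝ))) * (L : ℝ≥0∞) ^ 2 := by
      intro s hs
      rw [lintegral_const_mul' _ _ ENNReal.ofReal_ne_top]
      gcongr
      calc ∫⁻ y, ‖w s y‖ₑ * ‖w s y‖ₑ = ∫⁻ y, ‖w s y‖ₑ ^ 2 := lintegral_congr fun y => by rw [sq]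
        _ ≤ (L : ℝ≥0∞) ^ 2 := hsl s hs
    calc ∫⁻ s in Ioo 0 S, ∫⁻ y, ENNReal.ofReal ((S - s) ^ (-(1 / 2 : ℝ))) * (‖w s y‖ₑ * ‖w s y‖ₑ)
        ≤ ∫⁻ s in Ioo 0 S, ENNReal.ofReal ((S - s) ^ (-(1 / 2 : ℝ))) * (L : ℝ≥0∞) ^ 2 :=
          setLIntegral_mono' measurableSet_Ioo hslice
      _ = ENNReal.ofReal (2 * Real.sqrt (S - 0)) * (L : ℝ≥0∞) ^ 2 := by
          rw [lintegral_mul_const' _ _ (ENNReal.pow_ne_top ENNReal.coe_ne_top),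
            setLIntegral_Ioo_sub_rpow_neg_half_of_lt hS]
      _ < ∞ := ENNReal.mul_lt_top ENNReal.ofReal_lt_top (ENNReal.pow_lt_top ENNReal.coe_lt_top)

/-- **Pointwise bound for the Fourier transform of a tested slice of `B(w,w)(S)`**
(Koch–Tataru 2001, (8) and (11), through `fourier_inner_kochTataruBilinear_slice`): for `w`
bounded by `M`, jointly measurable, of finite Koch–Tataru norm, with `L²` slices bounded by `L` on
`(0, S)`,
`|𝓕⟪B(w,w)(S), w₀⟫(ξ)| ≤ 2π|ξ||w₀| ∫_{(0,S)} e^{-4π²(S-s)|ξ|²} Σ_{k,l} |𝓕(w_k w_l(s))(ξ)| ds`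
(Fubini over `(0,S) × ℝ^ι`, the coordinate expansion
`⟨ξ, w⟩⟨P(ξ)w, w₀⟩ = Σ_{k,l} ξ_k (P(ξ)w₀)_l w_k w_l` and `|P(ξ)w₀| ≤ |w₀|`).
[cite: KochTataruAdvMath2001, §2 (8), §3 (11)] -/
theorem norm_fourier_inner_kochTataruBilinear_le
    (hw : AEStronglyMeasurable (uncurry w) (volume : Measure (ℝ × (EuclideanSpace ℝ ι)))) (hM : 0 ≤ M)
    (hwM : ∀ s y, ‖w s y‖ ≤ M) (hX : eKochTataruNorm w < ∞) (hS : 0 < S)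
    (hw2 : ∀ s ∈ Ioo 0 S, MemLp (w s) 2 volume ∧ eLpNorm (w s) 2 volume ≤ L) (w₀ ξ : (EuclideanSpace ℝ ι)) :
    ‖𝓕 (fun x => ((⟪kochTataruBilinear w w S x, w₀⟫ : ℝ) : ℂ)) ξ‖ ≤
      2 * π * ‖ξ‖ * ‖w₀‖ * ∫ s in Ioo 0 S, heatSymbol (S - s) ξ *
        ∑ k, ∑ l, ‖𝓕 (fun y => (((w s y) k * (w s y) l : ℝ) : ℂ)) ξ‖ := by
  have hw' : AEStronglyMeasurable (uncurry w)
      ((volume : Measure (ℝ × (EuclideanSpace ℝ ι))).restrict (Ioi 0 ×ˢ univ)) := hw.restrict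
  obtain ⟨hL2, hL1⟩ := lintegral_weight_enorm_mul_enorm_lt_top hw hS hw2
  rw [fourier_inner_kochTataruBilinear_slice hw' hw' hX hX hS hL1 w₀ ξ,
    volume_restrict_prod_univ_eq_prod]
  -- notation
  set μ : Measure (ℝ × (EuclideanSpace ℝ ι)) := (volume.restrict (Ioo 0 S)).prod (volume : Measure (EuclideanSpace ℝ ι)) with hμ
  set c : (EuclideanSpace ℝ ι) := leraySymbol ξ w₀ with hc
  have hcle : ‖c‖ ≤ ‖w₀‖ := norm_leraySymbol_apply_le ξ w₀
  set g : ι → ι → ℝ → (EuclideanSpace ℝ ι) → ℂ := fun k l s y => (((w s y) k * (w s y) l : ℝ) : ℂ) with hg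
  set Φ : ℝ × (EuclideanSpace ℝ ι) → ℂ := fun p => 𝐞 (-⟪p.2, ξ⟫) •
    (2 * π * Complex.I * (⟪ξ, w p.1 p.2⟫ : ℝ) * (heatSymbol (S - p.1) ξ : ℝ) *
      (⟪leraySymbol ξ (w p.1 p.2), w₀⟫ : ℝ)) with hΦ
  have hPsymm : ∀ v : (EuclideanSpace ℝ ι), ⟪leraySymbol ξ v, w₀⟫ = ⟪v, c⟫ := by
    intro v
    rw [hc, inner_leraySymbol_apply, real_inner_comm (leraySymbol ξ w₀) v, inner_leraySymbol_apply,
      real_inner_comm v w₀, mul_comm ⟪ξ, w₀⟫ ⟪ξ, v⟫]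
  -- pointwise majorant of `Φ`
  have hΦbound : ∀ p : ℝ × (EuclideanSpace ℝ ι), p.1 < S → ‖Φ p‖ ≤ 2 * π * ‖ξ‖ * ‖w₀‖ * ‖w p.1 p.2‖ ^ 2 := by
    intro p hp
    have hh0 := (UnboundedOperators.heatSymbol_pos (S - p.1) ξ).le
    have hh1 := UnboundedOperators.heatSymbol_le_one (sub_pos.2 hp).le ξ
    rw [hΦ]
    dsimp only
    rw [Circle.norm_smul, hPsymm]
    simp only [norm_mul, Complex.norm_real, Complex.norm_I, mul_one, Complex.norm_ofNat,
      Real.norm_eq_abs, abs_of_pos Real.pi_pos]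
    calc 2 * π * |⟪ξ, w p.1 p.2⟫| * |heatSymbol (S - p.1) ξ| * |⟪w p.1 p.2, c⟫|
        ≤ 2 * π * (‖ξ‖ * ‖w p.1 p.2‖) * 1 * (‖w p.1 p.2‖ * ‖w₀‖) := by
          gcongr
          · exact abs_real_inner_le_norm _ _
          · rw [abs_of_nonneg hh0]; exact hh1
          · exact (abs_real_inner_le_norm _ _).trans
              (mul_le_mul_of_nonneg_left hcle (norm_nonneg _))
      _ = 2 * π * ‖ξ‖ * ‖w₀‖ * ‖w p.1 p.2‖ ^ 2 := by ring
  -- measurability and integrability of `Φ` on `(0,S) × ℝ^ι`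
  have hwr : AEStronglyMeasurable (fun p : ℝ × (EuclideanSpace ℝ ι) => w p.1 p.2) μ := by
    have := hw.mono_measure (Measure.restrict_le_self (s := Ioo 0 S ×ˢ univ))
    rw [volume_restrict_prod_univ_eq_prod] at this
    exact this
  have hΦm : AEStronglyMeasurable Φ μ := by
    rw [hΦ]
    have hchar : Continuous fun p : ℝ × (EuclideanSpace ℝ ι) => 𝐞 (-⟪p.2, ξ⟫) :=
      Real.continuous_fourierChar.comp (by fun_prop)
    refine hchar.aestronglyMeasurable.smul ?_
    refine AEStronglyMeasurable.mul (AEStronglyMeasurable.mul ?_ ?_) ?_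
    · exact ((Complex.continuous_ofReal.comp (continuous_const.inner continuous_id)).comp_aestronglyMeasurable
        hwr).const_mul _
    · refine Continuous.aestronglyMeasurable ?_
      unfold UnboundedOperators.heatSymbol
      fun_prop
    · exact (Complex.continuous_ofReal.comp
        ((leraySymbol ξ).continuous.inner continuous_const)).comp_aestronglyMeasurable hwr
  have hmemS : ∀ᵐ p ∂μ, p.1 ∈ Ioo 0 S := by
    rw [hμ, ← volume_restrict_prod_univ_eq_prod]
    filter_upwards [ae_restrict_mem (measurableSet_Ioo.prod MeasurableSet.univ)] with p hp
    exact hp.1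
  have hΦint : Integrable Φ μ := by
    refine ⟨hΦm, ?_⟩
    rw [hasFiniteIntegral_iff_enorm]
    have hae : ∀ᵐ p ∂μ, ‖Φ p‖ₑ ≤ ENNReal.ofReal (2 * π * ‖ξ‖ * ‖w₀‖) * ‖w p.1 p.2‖ₑ ^ 2 := by
      filter_upwards [hmemS] with p hp
      rw [← ofReal_norm, ← ofReal_norm, ← ENNReal.ofReal_pow (norm_nonneg _),
        ← ENNReal.ofReal_mul (by positivity)]
      exact ENNReal.ofReal_le_ofReal (hΦbound p hp.2)
    calc ∫⁻ p, ‖Φ p‖ₑ ∂μ ≤ ∫⁻ p, ENNReal.ofReal (2 * π * ‖ξ‖ * ‖w₀‖) * ‖w p.1 p.2‖ₑ ^ 2 ∂μ :=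
          lintegral_mono_ae hae
      _ = ENNReal.ofReal (2 * π * ‖ξ‖ * ‖w₀‖) * ∫⁻ p, ‖w p.1 p.2‖ₑ ^ 2 ∂μ :=
          lintegral_const_mul' _ _ ENNReal.ofReal_ne_top
      _ < ∞ := by
          refine ENNReal.mul_lt_top ENNReal.ofReal_lt_top (hL2.trans_lt ?_)
          exact ENNReal.mul_lt_top (ENNReal.pow_lt_top ENNReal.coe_lt_top) measure_Ioo_lt_top
  rw [integral_prod Φ hΦint]
  -- the inner integral at a time `s ∈ (0, S)`
  have hinner : ∀ s ∈ Ioo 0 S, ‖∫ y, Φ (s, y)‖ ≤ 2 * π * ‖ξ‖ * ‖w₀‖ *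
      (heatSymbol (S - s) ξ * ∑ k, ∑ l, ‖𝓕 (g k l s) ξ‖) := by
    intro s hs
    have hsl := fun k l => tensorSlice_integrable_memLp hM hwM (hw2 s hs).1 (hw2 s hs).2 k l
    -- coordinate expansion of the tensor pairing
    have h1 : ∀ v : (EuclideanSpace ℝ ι), ⟪ξ, v⟫ * ⟪v, c⟫ = ∑ k, ∑ l, (ξ k * c l) * (v k * v l) := by
      intro v
      have hi1 : ⟪ξ, v⟫ = ∑ k, ξ k * v k := by simp [PiLp.inner_apply, mul_comm]
      have hi2 : ⟪v, c⟫ = ∑ l, v l * c l := by simp [PiLp.inner_apply, mul_comm]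
      rw [hi1, hi2, Finset.sum_mul_sum]
      refine Finset.sum_congr rfl fun k _ => Finset.sum_congr rfl fun l _ => ?_
      ring
    have hexp : ∀ y, Φ (s, y) = (2 * π * Complex.I * (heatSymbol (S - s) ξ : ℝ)) *
        (𝐞 (-⟪y, ξ⟫) • ∑ k, ∑ l, ((ξ k * c l : ℝ) : ℂ) * g k l s y) := by
      intro y
      have h2 : (((⟪ξ, w s y⟫ * ⟪w s y, c⟫ : ℝ)) : ℂ) =
          ∑ k, ∑ l, ((ξ k * c l : ℝ) : ℂ) * g k l s y := by
        rw [h1]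
        push_cast [hg]
        rfl
      rw [hΦ]
      dsimp only
      rw [hPsymm, ← h2, Circle.smul_def, Circle.smul_def, smul_eq_mul, smul_eq_mul]
      push_cast
      ring
    have hF : ∫ y, Φ (s, y) = (2 * π * Complex.I * (heatSymbol (S - s) ξ : ℝ)) *
        ∑ k, ∑ l, ((ξ k * c l : ℝ) : ℂ) * 𝓕 (g k l s) ξ := by
      rw [show (fun y => Φ (s, y)) = fun y => (2 * π * Complex.I * (heatSymbol (S - s) ξ : ℝ)) *
          (𝐞 (-⟪y, ξ⟫) • ∑ k, ∑ l, ((ξ k * c l : ℝ) : ℂ) * g k l s y) from funext hexp,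
        integral_const_mul]
      congr 1
      rw [← Real.fourier_eq]
      have hinn : ∀ k ∈ Finset.univ, Integrable (fun y => ∑ l, ((ξ k * c l : ℝ) : ℂ) * g k l s y) :=
        fun k _ => integrable_finsetSum _ fun l _ => (hsl k l).1.const_mul _
      rw [show (fun y => ∑ k, ∑ l, ((ξ k * c l : ℝ) : ℂ) * g k l s y) =
          fun y => ∑ k, (1 : ℂ) * ∑ l, ((ξ k * c l : ℝ) : ℂ) * g k l s y by
            funext y; simp only [one_mul],
        fourier_finset_sum_const_mul Finset.univ hinn (fun _ => (1 : ℂ)) ξ]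
      simp only [one_mul]
      refine Finset.sum_congr rfl fun k _ => ?_
      exact fourier_finset_sum_const_mul Finset.univ (fun l _ => (hsl k l).1) _ ξ
    rw [hF, norm_mul]
    have hcoef : ‖2 * π * Complex.I * (heatSymbol (S - s) ξ : ℝ)‖ = 2 * π * heatSymbol (S - s) ξ := by
      simp only [norm_mul, Complex.norm_real, Complex.norm_I, mul_one, Complex.norm_ofNat,
        Real.norm_eq_abs, abs_of_pos Real.pi_pos,
        abs_of_pos (UnboundedOperators.heatSymbol_pos (S - s) ξ)]
    rw [hcoef]
    have hsum : ‖∑ k, ∑ l, ((ξ k * c l : ℝ) : ℂ) * 𝓕 (g k l s) ξ‖ ≤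
        ‖ξ‖ * ‖w₀‖ * ∑ k, ∑ l, ‖𝓕 (g k l s) ξ‖ := by
      rw [Finset.mul_sum]
      refine (norm_sum_le _ _).trans (Finset.sum_le_sum fun k _ => ?_)
      rw [Finset.mul_sum]
      refine (norm_sum_le _ _).trans (Finset.sum_le_sum fun l _ => ?_)
      rw [norm_mul, Complex.norm_real, Real.norm_eq_abs, abs_mul]
      gcongr
      · exact abs_coord_le_euclideanNorm ξ k
      · exact (abs_coord_le_euclideanNorm c l).trans hcle
    calc 2 * π * heatSymbol (S - s) ξ * ‖∑ k, ∑ l, ((ξ k * c l : ℝ) : ℂ) * 𝓕 (g k l s) ξ‖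
        ≤ 2 * π * heatSymbol (S - s) ξ * (‖ξ‖ * ‖w₀‖ * ∑ k, ∑ l, ‖𝓕 (g k l s) ξ‖) :=
          mul_le_mul_of_nonneg_left hsum
            (by have := (UnboundedOperators.heatSymbol_pos (S - s) ξ).le; positivity)
      _ = _ := by ring
  -- integrability of both sides of the time inequality
  have hint1 : IntegrableOn (fun s => ‖∫ y, Φ (s, y)‖) (Ioo 0 S) :=
    (hΦint.integral_prod_left).norm
  have hbdd : ∀ s ∈ Ioo 0 S, ‖heatSymbol (S - s) ξ * ∑ k, ∑ l, ‖𝓕 (g k l s) ξ‖‖ ≤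
      (Fintype.card ι : ℝ) ^ 2 * (L : ℝ) ^ 2 := by
    intro s hs
    rw [Real.norm_eq_abs, abs_of_nonneg (mul_nonneg (UnboundedOperators.heatSymbol_pos _ _).le
      (Finset.sum_nonneg fun k _ => Finset.sum_nonneg fun l _ => norm_nonneg _))]
    calc heatSymbol (S - s) ξ * ∑ k, ∑ l, ‖𝓕 (g k l s) ξ‖
        ≤ 1 * ∑ k, ∑ _l, (L : ℝ) ^ 2 := by
          refine mul_le_mul (UnboundedOperators.heatSymbol_le_one (sub_pos.2 hs.2).le ξ)
            (Finset.sum_le_sum fun k _ => Finset.sum_le_sum fun l _ =>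
              norm_fourier_tensorSlice_le (hw2 s hs).1 (hw2 s hs).2 k l ξ)
            (Finset.sum_nonneg fun k _ => Finset.sum_nonneg fun l _ => norm_nonneg _) zero_le_one
      _ = (Fintype.card ι : ℝ) ^ 2 * (L : ℝ) ^ 2 := by
          simp only [Finset.sum_const, Finset.card_univ, nsmul_eq_mul, one_mul]
          ring
  have hmeas2 : AEStronglyMeasurable (fun s => heatSymbol (S - s) ξ * ∑ k, ∑ l, ‖𝓕 (g k l s) ξ‖)
      (volume.restrict (Ioo 0 S)) := by
    refine AEStronglyMeasurable.mul (Continuous.aestronglyMeasurable ?_) ?_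
    · unfold UnboundedOperators.heatSymbol
      fun_prop
    · refine Finset.aestronglyMeasurable_fun_sum _ fun k _ =>
        Finset.aestronglyMeasurable_fun_sum _ fun l _ => ?_
      exact (aestronglyMeasurable_fourier_tensor_left hw k l ξ).norm.restrict
  have hint2 : IntegrableOn (fun s => 2 * π * ‖ξ‖ * ‖w₀‖ *
      (heatSymbol (S - s) ξ * ∑ k, ∑ l, ‖𝓕 (g k l s) ξ‖)) (Ioo 0 S) := by
    refine Integrable.const_mul ?_ _
    refine Integrable.mono' (integrable_const ((Fintype.card ι : ℝ) ^ 2 * (L : ℝ) ^ 2)) hmeas2 ?_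
    exact (ae_restrict_mem measurableSet_Ioo).mono hbdd
  calc ‖∫ s in Ioo 0 S, ∫ y, Φ (s, y)‖ ≤ ∫ s in Ioo 0 S, ‖∫ y, Φ (s, y)‖ :=
        norm_integral_le_integral_norm _
    _ ≤ ∫ s in Ioo 0 S, 2 * π * ‖ξ‖ * ‖w₀‖ *
          (heatSymbol (S - s) ξ * ∑ k, ∑ l, ‖𝓕 (g k l s) ξ‖) :=
        setIntegral_mono_on hint1 hint2 measurableSet_Ioo hinner
    _ = 2 * π * ‖ξ‖ * ‖w₀‖ * ∫ s in Ioo 0 S, heatSymbol (S - s) ξ * ∑ k, ∑ l, ‖𝓕 (g k l s) ξ‖ :=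
        integral_const_mul _ _

end FourierSlice

/-! ### The `Ḣ^σ` bound for `B(w, w)(S)`: Minkowski in time and Plancherel -/

section Sobolev

variable {w : ℝ → (EuclideanSpace ℝ ι) → (EuclideanSpace ℝ ι)} {M S : ℝ} {L : ℝ≥0}

/-- The Euclidean norm is at most the sum of the coordinate norms (`ℓ² ≤ ℓ¹`). [folklore] -/
theorem euclideanNorm_le_sum_norm_coord (z : EuclideanSpace ℂ ι) : ‖z‖ ≤ ∑ j, ‖z j‖ := by
  classical
  calc ‖z‖ = ‖∑ j, z j • EuclideanSpace.single j (1 : ℂ)‖ := by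
        conv_lhs => rw [← (EuclideanSpace.basisFun ι ℂ).sum_repr z]
        simp [EuclideanSpace.basisFun_apply]
    _ ≤ ∑ j, ‖z j • EuclideanSpace.single j (1 : ℂ)‖ := norm_sum_le _ _
    _ = ∑ j, ‖z j‖ := by simp [norm_smul]

/-- **Components of the Fourier transform of a complexified real field**: for an integrable
`B : ℝ^ι → ℝ^ι`, `(𝓕(complexify ∘ B)(ξ))_j = 𝓕(⟪B, e_j⟫)(ξ)` (the coordinate functional passes
through the Bochner integral). [folklore] -/
theorem fourier_complexify_apply [DecidableEq ι] {B : (EuclideanSpace ℝ ι) → (EuclideanSpace ℝ ι)}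
    (hB : Integrable B) (ξ : EuclideanSpace ℝ ι) (j : ι) :
    (𝓕 (complexify ∘ B) ξ) j = 𝓕 (fun x => ((⟪B x, EuclideanSpace.single j (1 : ℝ)⟫ : ℝ) : ℂ)) ξ := by
  have hint : Integrable (fun x => 𝐞 (-⟪x, ξ⟫) • (complexify ∘ B) x) :=
    (Real.fourierIntegral_convergent_iff ξ).2 (memLp_one_iff_integrable.1
      (memLp_complexify_comp (memLp_one_iff_integrable.2 hB)))
  rw [Real.fourier_eq, Real.fourier_eq]
  have h := (ContinuousLinearMap.integral_comp_comm (EuclideanSpace.proj j : EuclideanSpace ℂ ι →L[ℂ] ℂ)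
    hint).symm
  have hproj : ∀ v : EuclideanSpace ℂ ι, (EuclideanSpace.proj j : EuclideanSpace ℂ ι →L[ℂ] ℂ) v = v j :=
    fun v => rfl
  rw [hproj] at h
  rw [h]
  refine integral_congr_ae (Eventually.of_forall fun x => ?_)
  show (EuclideanSpace.proj j : EuclideanSpace ℂ ι →L[ℂ] ℂ) (𝐞 (-⟪x, ξ⟫) • (complexify ∘ B) x) =
    𝐞 (-⟪x, ξ⟫) • (((⟪B x, EuclideanSpace.single j (1 : ℝ)⟫ : ℝ)) : ℂ)
  rw [hproj, Circle.smul_def, Circle.smul_def, PiLp.smul_apply, smul_eq_mul, smul_eq_mul,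
    Function.comp_apply, FunctionSpaces.EuclideanSpace.complexify_apply]
  simp [EuclideanSpace.inner_single_right]

/-- **The weighted `L²` bound of `𝓕(B(w,w)(S))`**, i.e. `‖B(w,w)(S)‖_{Ḣ^σ}` computed on the
Fourier integral: for `w` bounded by `M`, jointly measurable, of finite Koch–Tataru norm, with
`L²` slices bounded by `L` on `(0, S)`, and `0 ≤ σ < 1`,
`(∫ ‖ξ‖^{2σ} ‖𝓕(complexify ∘ B(w,w)(S))(ξ)‖² dξ)^{1/2} ≤ |ι|³ 2π ((2π)²)^{-(1+σ)/2} S^{(1-σ)/2} (2/(1-σ)) M L`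
(pointwise symbol bound `norm_fourier_inner_kochTataruBilinear_le`, Minkowski's integral
inequality in time, the weight bound `norm_rpow_mul_heatSymbol_le`, Plancherel for the tensor
slices; Lemarié-Rieusset 2016, proof of Thm. 7.4, p. 151, `‖W_{νσ} * ℙ∇·(u⊗u)‖_{Ḣ^{1/2}} ≤ C(νσ)^{-3/4}‖u⊗u‖₂`).
[cite: LemarieRieusset2016, Thm. 7.4 (proof, PDF p. 151)] -/
theorem lintegral_hom_weight_fourier_kochTataruBilinear_le
    (hw : AEStronglyMeasurable (uncurry w) (volume : Measure (ℝ × (EuclideanSpace ℝ ι)))) (hM : 0 ≤ M)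
    (hwM : ∀ s y, ‖w s y‖ ≤ M) (hX : eKochTataruNorm w < ∞) (hS : 0 < S)
    (hw2 : ∀ s ∈ Ioo 0 S, MemLp (w s) 2 volume ∧ eLpNorm (w s) 2 volume ≤ L)
    {σ : ℝ} (hσ₀ : 0 ≤ σ) (hσ₁ : σ < 1) :
    (∫⁻ ξ, ‖ξ‖ₑ ^ (2 * σ) * ‖𝓕 (complexify ∘ kochTataruBilinear w w S) ξ‖ₑ ^ (2 : ℕ)) ^ (1 / 2 : ℝ) ≤
      ENNReal.ofReal ((Fintype.card ι : ℝ) ^ 3 * (2 * π) * ((2 * π) ^ 2) ^ (-((1 + σ) / 2)) *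
        (S ^ ((1 - σ) / 2) / ((1 - σ) / 2)) * M) * L := by
  classical
  set B : (EuclideanSpace ℝ ι) → (EuclideanSpace ℝ ι) := kochTataruBilinear w w S with hB
  set g : ι → ι → ℝ → (EuclideanSpace ℝ ι) → ℂ := fun k l s y => (((w s y) k * (w s y) l : ℝ) : ℂ) with hg
  have hw' : AEStronglyMeasurable (uncurry w)
      ((volume : Measure (ℝ × (EuclideanSpace ℝ ι))).restrict (Ioi 0 ×ˢ univ)) := hw.restrict
  obtain ⟨-, hL1⟩ := lintegral_weight_enorm_mul_enorm_lt_top hw hS hw2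
  have hBint : Integrable B := integrable_kochTataruBilinear_slice hw' hw' hL1
  -- the time profile `F ξ s` and the pointwise bound
  set F : (EuclideanSpace ℝ ι) → ℝ → ℝ := fun ξ s =>
    (2 * π * (‖ξ‖ ^ σ * ‖ξ‖) * heatSymbol (S - s) ξ) * ∑ k, ∑ l, ‖𝓕 (g k l s) ξ‖ with hF
  have hFnn : ∀ ξ s, 0 ≤ F ξ s := fun ξ s => by
    rw [hF]
    have := (UnboundedOperators.heatSymbol_pos (S - s) ξ).le
    exact mul_nonneg (by positivity) (Finset.sum_nonneg fun k _ => Finset.sum_nonneg fun l _ => norm_nonneg _)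
  have hpt : ∀ ξ, ‖ξ‖ ^ σ * ‖𝓕 (complexify ∘ B) ξ‖ ≤ (Fintype.card ι : ℝ) * ∫ s in Ioo 0 S, F ξ s := by
    intro ξ
    have hcomp : ∀ j, ‖(𝓕 (complexify ∘ B) ξ) j‖ ≤ 2 * π * ‖ξ‖ *
        ∫ s in Ioo 0 S, heatSymbol (S - s) ξ * ∑ k, ∑ l, ‖𝓕 (g k l s) ξ‖ := by
      intro j
      rw [fourier_complexify_apply hBint ξ j]
      have h := norm_fourier_inner_kochTataruBilinear_le hw hM hwM hX hS hw2
        (EuclideanSpace.single j (1 : ℝ)) ξ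
      have hn : ‖EuclideanSpace.single j (1 : ℝ)‖ = 1 := by simp
      rw [hn, mul_one] at h
      exact h
    have hI : ∫ s in Ioo 0 S, F ξ s = 2 * π * (‖ξ‖ ^ σ * ‖ξ‖) *
        ∫ s in Ioo 0 S, heatSymbol (S - s) ξ * ∑ k, ∑ l, ‖𝓕 (g k l s) ξ‖ := by
      rw [hF, ← integral_const_mul]
      refine integral_congr_ae (Eventually.of_forall fun s => ?_)
      ring
    calc ‖ξ‖ ^ σ * ‖𝓕 (complexify ∘ B) ξ‖ ≤ ‖ξ‖ ^ σ * ∑ j, ‖(𝓕 (complexify ∘ B) ξ) j‖ :=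
          mul_le_mul_of_nonneg_left (euclideanNorm_le_sum_norm_coord _) (by positivity)
      _ ≤ ‖ξ‖ ^ σ * ∑ _j : ι, 2 * π * ‖ξ‖ *
            ∫ s in Ioo 0 S, heatSymbol (S - s) ξ * ∑ k, ∑ l, ‖𝓕 (g k l s) ξ‖ :=
          mul_le_mul_of_nonneg_left (Finset.sum_le_sum fun j _ => hcomp j) (by positivity)
      _ = (Fintype.card ι : ℝ) * ∫ s in Ioo 0 S, F ξ s := by
          rw [hI, Finset.sum_const, Finset.card_univ, nsmul_eq_mul]
          ring
  -- squares: the weighted integrand is dominated by `‖card • ∫ F‖ₑ²`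
  set H : (EuclideanSpace ℝ ι) → ℝ := fun ξ => (Fintype.card ι : ℝ) * ∫ s in Ioo 0 S, F ξ s with hH
  have hHnn : ∀ ξ, 0 ≤ H ξ := fun ξ => mul_nonneg (Nat.cast_nonneg _)
    (setIntegral_nonneg measurableSet_Ioo fun s _ => hFnn ξ s)
  have hdom : ∀ ξ, ‖ξ‖ₑ ^ (2 * σ) * ‖𝓕 (complexify ∘ B) ξ‖ₑ ^ (2 : ℕ) ≤ ‖H ξ‖ₑ ^ (2 : ℕ) := by
    intro ξ
    have h1 : ‖ξ‖ₑ ^ (2 * σ) * ‖𝓕 (complexify ∘ B) ξ‖ₑ ^ (2 : ℕ) =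
        ENNReal.ofReal (‖ξ‖ ^ σ * ‖𝓕 (complexify ∘ B) ξ‖) ^ (2 : ℕ) := by
      rw [ENNReal.ofReal_mul (by positivity), mul_pow, ofReal_norm, ← ofReal_norm ξ,
        ENNReal.ofReal_rpow_of_nonneg (norm_nonneg _) (by positivity), ← ENNReal.ofReal_pow (by positivity),
        ← Real.rpow_natCast, ← Real.rpow_mul (norm_nonneg _)]
      norm_num
      rw [mul_comm σ 2]
    rw [h1, Real.enorm_eq_ofReal (hHnn ξ)]
    gcongr
    exact hpt ξ
  -- measurability of `F` on `ℝ^ι × (0, S)`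
  have hFm : AEStronglyMeasurable (uncurry F)
      ((volume : Measure (EuclideanSpace ℝ ι)).prod (volume.restrict (Ioo 0 S))) := by
    have hsw : AEStronglyMeasurable (fun q : (EuclideanSpace ℝ ι) × ℝ => ∑ k, ∑ l, ‖𝓕 (g k l q.2) q.1‖)
        ((volume : Measure (EuclideanSpace ℝ ι)).prod (volume : Measure ℝ)) := by
      refine Finset.aestronglyMeasurable_fun_sum _ fun k _ =>
        Finset.aestronglyMeasurable_fun_sum _ fun l _ => ?_
      have h := (aestronglyMeasurable_fourier_tensor hw k l).comp_quasiMeasurePreserving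
        (Measure.measurePreserving_swap (μ := (volume : Measure (EuclideanSpace ℝ ι)))
          (ν := (volume : Measure ℝ))).quasiMeasurePreserving
      exact h.norm
    have hsw' : AEStronglyMeasurable (fun q : (EuclideanSpace ℝ ι) × ℝ => ∑ k, ∑ l, ‖𝓕 (g k l q.2) q.1‖)
        ((volume : Measure (EuclideanSpace ℝ ι)).prod (volume.restrict (Ioo 0 S))) :=
      hsw.mono_measure (Measure.prod_mono le_rfl Measure.restrict_le_self)
    have hwt : Continuous fun q : (EuclideanSpace ℝ ι) × ℝ =>
        2 * π * (‖q.1‖ ^ σ * ‖q.1‖) * heatSymbol (S - q.2) q.1 := by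
      unfold UnboundedOperators.heatSymbol
      refine ((continuous_const.mul ((continuous_fst.norm.rpow_const fun q => Or.inr hσ₀).mul
        continuous_fst.norm)).mul ?_)
      fun_prop
    exact hwt.aestronglyMeasurable.mul hsw'
  -- Minkowski in time
  have hMink := FunctionSpaces.eLpNorm_integral_le_lintegral_eLpNorm hFm (p := 2) one_le_two
    ENNReal.ofNat_ne_top
  -- the slice bound at a time `s ∈ (0, S)`
  set a : ℝ := (1 + σ) / 2 with ha
  have ha₀ : 0 ≤ a := by rw [ha]; positivity
  have ha₁ : a ≤ 1 := by rw [ha]; linarith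
  have hslice : ∀ s ∈ Ioo 0 S, eLpNorm (fun ξ => F ξ s) 2 volume ≤
      ENNReal.ofReal (2 * π * ((2 * π) ^ 2 * (S - s)) ^ (-a)) *
        ((Fintype.card ι : ℝ≥0∞) ^ 2 * (ENNReal.ofReal M * L)) := by
    intro s hs
    have hθ : 0 < S - s := sub_pos.2 hs.2
    have hsl := fun k l => tensorSlice_integrable_memLp hM hwM (hw2 s hs).1 (hw2 s hs).2 k l
    -- the weight
    have hwgt : ∀ ξ : EuclideanSpace ℝ ι, 2 * π * (‖ξ‖ ^ σ * ‖ξ‖) * heatSymbol (S - s) ξ ≤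
        2 * π * ((2 * π) ^ 2 * (S - s)) ^ (-a) := by
      intro ξ
      have hn : ‖ξ‖ ^ σ * ‖ξ‖ = ‖ξ‖ ^ (2 * a) := by
        rw [ha, show 2 * ((1 + σ) / 2) = σ + 1 by ring, Real.rpow_add_one' (norm_nonneg _) (by linarith)]
      rw [hn, mul_assoc]
      exact mul_le_mul_of_nonneg_left (norm_rpow_mul_heatSymbol_le hθ ha₀ ha₁ ξ) (by positivity)
    -- the sum of Fourier transforms
    set Ψ : (EuclideanSpace ℝ ι) → ℝ := fun ξ => ∑ k, ∑ l, ‖𝓕 (g k l s) ξ‖ with hΨ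
    have hΨeq : Ψ = ∑ k, ∑ l, fun ξ => ‖𝓕 (g k l s) ξ‖ := by
      funext ξ
      simp only [hΨ, Finset.sum_apply]
    have hΨm : ∀ k l, AEStronglyMeasurable (fun ξ => ‖𝓕 (g k l s) ξ‖) (volume : Measure (EuclideanSpace ℝ ι)) :=
      fun k l => (FunctionSpaces.memLp_two_fourierIntegral (hsl k l).1 (hsl k l).2.1).1.norm
    have hΨle : eLpNorm Ψ 2 volume ≤ (Fintype.card ι : ℝ≥0∞) ^ 2 * (ENNReal.ofReal M * L) := by
      rw [hΨeq]
      calc eLpNorm (∑ k, ∑ l, fun ξ => ‖𝓕 (g k l s) ξ‖) 2 volume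
          ≤ ∑ k, eLpNorm (∑ l, fun ξ => ‖𝓕 (g k l s) ξ‖) 2 volume :=
            eLpNorm_sum_le (fun k _ => Finset.aestronglyMeasurable_sum _ fun l _ => hΨm k l) one_le_two
        _ ≤ ∑ k, ∑ l, eLpNorm (fun ξ => ‖𝓕 (g k l s) ξ‖) 2 volume :=
            Finset.sum_le_sum fun k _ => eLpNorm_sum_le (fun l _ => hΨm k l) one_le_two
        _ ≤ ∑ _k : ι, ∑ _l : ι, ENNReal.ofReal M * (L : ℝ≥0∞) := by
            refine Finset.sum_le_sum fun k _ => Finset.sum_le_sum fun l _ => ?_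
            rw [eLpNorm_norm, FunctionSpaces.eLpNorm_fourierIntegral_eq (hsl k l).1 (hsl k l).2.1]
            exact (hsl k l).2.2
        _ = (Fintype.card ι : ℝ≥0∞) ^ 2 * (ENNReal.ofReal M * L) := by
            simp only [Finset.sum_const, Finset.card_univ, nsmul_eq_mul]
            ring
    have hptF : ∀ ξ, ‖F ξ s‖ ≤ ‖((2 * π * ((2 * π) ^ 2 * (S - s)) ^ (-a)) • Ψ) ξ‖ := by
      intro ξ
      have hΨnn : 0 ≤ Ψ ξ := Finset.sum_nonneg fun k _ => Finset.sum_nonneg fun l _ => norm_nonneg _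
      rw [Real.norm_of_nonneg (hFnn ξ s), Pi.smul_apply, smul_eq_mul,
        Real.norm_of_nonneg (mul_nonneg (by positivity) hΨnn), hF]
      exact mul_le_mul_of_nonneg_right (hwgt ξ) hΨnn
    calc eLpNorm (fun ξ => F ξ s) 2 volume
        ≤ eLpNorm ((2 * π * ((2 * π) ^ 2 * (S - s)) ^ (-a)) • Ψ) 2 volume := eLpNorm_mono hptF
      _ = ENNReal.ofReal (2 * π * ((2 * π) ^ 2 * (S - s)) ^ (-a)) * eLpNorm Ψ 2 volume := by
          rw [eLpNorm_const_smul, Real.enorm_eq_ofReal (by positivity)]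
      _ ≤ _ := mul_le_mul' le_rfl hΨle
  -- the time integral of the slice bounds
  have htime : ∫⁻ s in Ioo 0 S, eLpNorm (fun ξ => F ξ s) 2 volume ≤
      ENNReal.ofReal (2 * π * ((2 * π) ^ 2) ^ (-a) * (S ^ (1 - a) / (1 - a))) *
        ((Fintype.card ι : ℝ≥0∞) ^ 2 * (ENNReal.ofReal M * L)) := by
    calc ∫⁻ s in Ioo 0 S, eLpNorm (fun ξ => F ξ s) 2 volume
        ≤ ∫⁻ s in Ioo 0 S, ENNReal.ofReal (2 * π * ((2 * π) ^ 2 * (S - s)) ^ (-a)) *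
            ((Fintype.card ι : ℝ≥0∞) ^ 2 * (ENNReal.ofReal M * L)) := setLIntegral_mono' measurableSet_Ioo hslice
      _ = (∫⁻ s in Ioo 0 S, ENNReal.ofReal (2 * π * ((2 * π) ^ 2) ^ (-a)) *
            ENNReal.ofReal ((S - s) ^ (-a))) * ((Fintype.card ι : ℝ≥0∞) ^ 2 * (ENNReal.ofReal M * L)) := by
          rw [← lintegral_mul_const' _ _ (ENNReal.mul_ne_top (ENNReal.pow_ne_top (ENNReal.natCast_ne_top _))
            (ENNReal.mul_ne_top ENNReal.ofReal_ne_top ENNReal.coe_ne_top))]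
          refine setLIntegral_congr_fun measurableSet_Ioo fun s hs => ?_
          rw [← ENNReal.ofReal_mul (by positivity), Real.mul_rpow (by positivity) (sub_pos.2 hs.2).le]
          ring_nf
      _ = _ := by
          rw [lintegral_const_mul' _ _ ENNReal.ofReal_ne_top, lintegral_Ioo_ofReal_sub_rpow_neg hS
            (by rw [ha]; linarith), ← ENNReal.ofReal_mul (by positivity)]
  -- assembly
  have hId : (∫⁻ ξ, ‖H ξ‖ₑ ^ (2 : ℕ)) ^ (1 / 2 : ℝ) = eLpNorm H 2 volume := by
    rw [eLpNorm_eq_lintegral_rpow_enorm_toReal two_ne_zero ENNReal.ofNat_ne_top]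
    simp only [ENNReal.toReal_ofNat, ENNReal.rpow_ofNat, one_div]
  have hHeq : H = (Fintype.card ι : ℝ) • fun ξ => ∫ s in Ioo 0 S, F ξ s := by
    funext ξ; simp only [hH, Pi.smul_apply, smul_eq_mul]
  have h1a : 1 - a = (1 - σ) / 2 := by rw [ha]; ring
  calc (∫⁻ ξ, ‖ξ‖ₑ ^ (2 * σ) * ‖𝓕 (complexify ∘ B) ξ‖ₑ ^ (2 : ℕ)) ^ (1 / 2 : ℝ)
      ≤ (∫⁻ ξ, ‖H ξ‖ₑ ^ (2 : ℕ)) ^ (1 / 2 : ℝ) := by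
        gcongr
        exact hdom _
    _ = eLpNorm H 2 volume := hId
    _ = ENNReal.ofReal (Fintype.card ι : ℝ) * eLpNorm (fun ξ => ∫ s in Ioo 0 S, F ξ s) 2 volume := by
        rw [hHeq, eLpNorm_const_smul, Real.enorm_eq_ofReal (Nat.cast_nonneg _)]
    _ ≤ ENNReal.ofReal (Fintype.card ι : ℝ) * (ENNReal.ofReal (2 * π * ((2 * π) ^ 2) ^ (-a) *
          (S ^ (1 - a) / (1 - a))) * ((Fintype.card ι : ℝ≥0∞) ^ 2 * (ENNReal.ofReal M * L))) :=
        mul_le_mul' le_rfl (hMink.trans htime)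
    _ = _ := by
        rw [h1a, ← ENNReal.ofReal_natCast, ← ENNReal.ofReal_pow (Nat.cast_nonneg _)]
        rw [show ∀ a b c d e : ℝ≥0∞, a * (b * (c * (d * e))) = (a * b * c * d) * e from fun _ _ _ _ _ => by ring]
        congr 1
        rw [← ENNReal.ofReal_mul (Nat.cast_nonneg _), ← ENNReal.ofReal_mul (by positivity),
          ← ENNReal.ofReal_mul (by positivity)]
        congr 1
        ring

/-- `B(w,w)(S) ∈ L²` with measurable slices, for `w` bounded and jointly measurable on `(0,S) × ℝ^ι`
with `L²` slices bounded by `L` (the tree's `L^p` bound with one bounded factor,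
`exists_eLpNorm_oseenDuhamel_le_left`, and `aestronglyMeasurable_oseenDuhamel`, for `ν = 1`).
[cite: LemarieRieusset2016, Prop. 7.3 (7.32)–(7.33) (PDF p. 152)] -/
theorem memLp_two_kochTataruBilinear
    (hw : AEStronglyMeasurable (uncurry w) (volume : Measure (ℝ × (EuclideanSpace ℝ ι)))) (hM : 0 ≤ M)
    (hwM : ∀ s y, ‖w s y‖ ≤ M) (hS : 0 < S)
    (hw2 : ∀ s ∈ Ioo 0 S, MemLp (w s) 2 volume ∧ eLpNorm (w s) 2 volume ≤ L) :
    MemLp (kochTataruBilinear w w S) 2 volume := by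
  have hwr : AEStronglyMeasurable (uncurry w)
      ((volume : Measure (ℝ × (EuclideanSpace ℝ ι))).restrict (Ioo 0 S ×ˢ univ)) := hw.restrict
  have hbd : ∀ τ ∈ Ioo 0 S, ∀ y, ‖w τ y‖ ≤ M := fun τ _ y => hwM τ y
  obtain ⟨C, -, hle⟩ := exists_eLpNorm_oseenDuhamel_le_left (E := EuclideanSpace ℝ ι)
  have h := hle one_pos hwr hwr hM hbd hbd (p := 2) (by norm_num) (by norm_num)
    (L := (L : ℝ≥0∞)) (fun τ hτ => (hw2 τ hτ).2) hS le_rfl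
  rw [kochTataruBilinear_eq_oseenDuhamel]
  refine ⟨aestronglyMeasurable_oseenDuhamel one_pos hwr hwr hM hbd hbd hS le_rfl, ?_⟩
  exact h.trans_lt (ENNReal.mul_lt_top ENNReal.ofReal_lt_top ENNReal.coe_lt_top)

end Sobolev

/-! ### Nonzero complex multiples in `Ḣ^σ ∩ L²` -/

section Smul

variable {E' F : Type*} [NormedAddCommGroup E'] [InnerProductSpace ℝ E'] [FiniteDimensional ℝ E']
  [MeasurableSpace E'] [BorelSpace E'] [NormedAddCommGroup F] [InnerProductSpace ℂ F] [CompleteSpace F]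

/-- `‖c • f‖_{Ḣ^s} ≤ |c| ‖f‖_{Ḣ^s}` for a nonzero complex constant (in fact equality; `𝓕` is
linear). [folklore] -/
theorem eHomSobolevSeminorm_complex_smul_le (s : ℝ) {c : ℂ} (hc : c ≠ 0) (f : E' → F) :
    Function.eHomSobolevSeminorm s (c • f) ≤ ‖c‖ₑ * Function.eHomSobolevSeminorm s f := by
  by_cases hf : MemLp f 2 (volume : Measure E')
  · rw [Function.eHomSobolevSeminorm_of_memLp (hf.const_smul c), Function.eHomSobolevSeminorm_of_memLp hf,
      MemLp.toLp_const_smul c hf, FunctionSpaces.eHomSobolevSeminorm_eq_eLpNorm_fourier,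
      FunctionSpaces.eHomSobolevSeminorm_eq_eLpNorm_fourier, FourierSMul.fourier_smul]
    have hac : FunctionSpaces.homSobolevMeasure E' s ≪ (volume : Measure E') :=
      withDensity_absolutelyContinuous _ _
    rw [eLpNorm_congr_ae (hac.ae_eq (Lp.coeFn_smul c _)), eLpNorm_const_smul]
  · rw [Function.eHomSobolevSeminorm_of_not_memLp hf, ENNReal.mul_top (by simpa using hc)]
    exact le_top

/-- `Ḣ^s ∩ L²` is stable under nonzero complex multiples. [folklore] -/
theorem memHomSobolev_complex_smul {s : ℝ} {f : E' → F} (hf : FunctionSpaces.MemHomSobolev s f)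
    {c : ℂ} (hc : c ≠ 0) : FunctionSpaces.MemHomSobolev s (c • f) := by
  rw [FunctionSpaces.memHomSobolev_iff] at hf ⊢
  exact ⟨hf.1.const_smul c, (eHomSobolevSeminorm_complex_smul_le s hc f).trans_lt
    (ENNReal.mul_lt_top (by simp) hf.2)⟩

end Smul

/-! ### The Oseen–Duhamel term `B^ν_0(u,u)(t)` of a bounded slab field with `L²` slices -/

section Oseen

/-- **The bilinear Duhamel term of Oseen's scheme gains `Ḣ^σ` regularity, `σ < 1`**
(Lemarié-Rieusset 2016, proof of Thm. 7.4, PDF p. 151: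
`‖∫₀ᵗ W_{ν(t-s)} * ℙ∇·(u⊗u) ds‖_{Ḣ^{1/2}} ≤ C∫₀ᵗ (ν(t-s))^{-3/4}‖u⊗u‖₂ ds`, with
`‖u ⊗ u‖₂ ≤ ‖u‖_∞‖u‖₂`, proof of Thm. 9.11, p. 256). For `0 ≤ σ < 1` there is `C = C(ι, σ) ≥ 0`
such that for `ν > 0`, a field `u` jointly measurable on `(0, T) × ℝ^ι`, bounded there by `M ≥ 0`,
with slices `u(τ) ∈ L²`, `‖u(τ)‖_{L²} ≤ L` for `τ ∈ (0, T)`, and `0 < t ≤ T`: the Duhamel term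
`B^ν_0(u,u)(t) = oseenDuhamel ν 0 u u t` lies in `L²`, its complexification lies in `Ḣ^σ ∩ L²`, and
`‖B^ν_0(u,u)(t)‖_{Ḣ^σ} ≤ C ν^{-(1+σ)/2} t^{(1-σ)/2} M L`. Proof: rescale to Koch–Tataru's
`B(ũ,ũ)(νt) = ν B^ν_0(u,u)(t)` and apply `lintegral_hom_weight_fourier_kochTataruBilinear_le`.
[cite: LemarieRieusset2016, Thm. 7.4 (proof, PDF p. 151)] -/
theorem exists_eHomSobolevSeminorm_oseenDuhamel_le {σ : ℝ} (hσ₀ : 0 ≤ σ) (hσ₁ : σ < 1) :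
    ∃ C : ℝ, 0 ≤ C ∧ ∀ ⦃ν T M : ℝ⦄ ⦃L : ℝ≥0⦄
      ⦃u : ℝ → (EuclideanSpace ℝ ι) → (EuclideanSpace ℝ ι)⦄, 0 < ν →
      AEStronglyMeasurable (uncurry u)
        ((volume : Measure (ℝ × (EuclideanSpace ℝ ι))).restrict (Ioo 0 T ×ˢ univ)) →
      0 ≤ M → (∀ τ ∈ Ioo 0 T, ∀ y, ‖u τ y‖ ≤ M) →
      (∀ τ ∈ Ioo 0 T, MemLp (u τ) 2 volume ∧ eLpNorm (u τ) 2 volume ≤ L) →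
      ∀ ⦃t : ℝ⦄, 0 < t → t ≤ T →
        MemLp (oseenDuhamel ν 0 u u t) 2 volume ∧
        FunctionSpaces.MemHomSobolev σ (complexify ∘ oseenDuhamel ν 0 u u t) ∧
        Function.eHomSobolevSeminorm σ (complexify ∘ oseenDuhamel ν 0 u u t) ≤
          ENNReal.ofReal (C * ν ^ (-((1 + σ) / 2)) * t ^ ((1 - σ) / 2) * M) * L := by
  set C₀ : ℝ := (Fintype.card ι : ℝ) ^ 3 * (2 * π) * ((2 * π) ^ 2) ^ (-((1 + σ) / 2)) with hC₀
  have hC₀nn : 0 ≤ C₀ := by rw [hC₀]; positivity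
  have h1σ : 0 < 1 - σ := by linarith
  refine ⟨C₀ * (2 / (1 - σ)), by positivity, ?_⟩
  intro ν T M L u hν hu hM hubd hu2 t ht htT
  -- truncation to `(0, T)` and parabolic rescaling to viscosity `1`
  set ut : ℝ → (EuclideanSpace ℝ ι) → (EuclideanSpace ℝ ι) := (Ioo 0 T).indicator u with hut
  set W : ℝ → (EuclideanSpace ℝ ι) → (EuclideanSpace ℝ ι) :=
    (Ioo 0 (ν * t)).indicator (fun s => ut (s / ν)) with hW
  have hWapp : ∀ s y, W s y =
      if s ∈ Ioo 0 (ν * t) then (if s / ν ∈ Ioo 0 T then u (s / ν) y else 0) else 0 := by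
    intro s y
    rw [hW]
    by_cases hs : s ∈ Ioo 0 (ν * t)
    · rw [indicator_of_mem hs, if_pos hs, hut]
      by_cases hs' : s / ν ∈ Ioo 0 T
      · rw [indicator_of_mem hs', if_pos hs']
      · rw [indicator_of_notMem hs', if_neg hs']
        rfl
    · rw [indicator_of_notMem hs, if_neg hs]
      rfl
  have hdivmem : ∀ s ∈ Ioo 0 (ν * t), s / ν ∈ Ioo 0 T := fun s hs =>
    ⟨div_pos hs.1 hν, by rw [div_lt_iff₀ hν]; nlinarith [hs.2, ht, htT]⟩
  have hWslice : ∀ s ∈ Ioo 0 (ν * t), W s = u (s / ν) := fun s hs => by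
    funext y
    rw [hWapp, if_pos hs, if_pos (hdivmem s hs)]
  have hWM : ∀ s y, ‖W s y‖ ≤ M := by
    intro s y
    rw [hWapp]
    split_ifs with h1 h2
    · exact hubd _ h2 y
    · simpa using hM
    · simpa using hM
  have hWzero : ∀ s, ν * t ≤ s → W s = 0 := fun s hs => by
    funext y
    rw [hWapp, if_neg (fun h => not_lt.2 hs h.2)]
    rfl
  have hWX : eKochTataruNorm W < ∞ := eKochTataruNorm_lt_top_of_bound_of_eq_zero hM hWM hWzero
  have hW2 : ∀ s ∈ Ioo 0 (ν * t), MemLp (W s) 2 volume ∧ eLpNorm (W s) 2 volume ≤ L := fun s hs => by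
    rw [hWslice s hs]
    exact hu2 _ (hdivmem s hs)
  -- joint measurability of `W`
  have hWm : AEStronglyMeasurable (uncurry W) (volume : Measure (ℝ × (EuclideanSpace ℝ ι))) := by
    have h1 : AEStronglyMeasurable ((Ioo 0 T ×ˢ (univ : Set (EuclideanSpace ℝ ι))).indicator (uncurry u))
        (volume : Measure (ℝ × (EuclideanSpace ℝ ι))) :=
      (aestronglyMeasurable_indicator_iff (measurableSet_Ioo.prod MeasurableSet.univ)).2 hu
    have hd : Measure.QuasiMeasurePreserving (fun s : ℝ => s / ν) volume volume := by
      refine ⟨measurable_id.div_const ν, ?_⟩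
      simp_rw [div_eq_mul_inv]
      rw [Real.map_volume_mul_right (inv_ne_zero hν.ne')]
      exact Measure.smul_absolutelyContinuous
    have hφ : Measure.QuasiMeasurePreserving
        (Prod.map (fun s : ℝ => s / ν) id : ℝ × (EuclideanSpace ℝ ι) → ℝ × (EuclideanSpace ℝ ι))
        (volume : Measure (ℝ × (EuclideanSpace ℝ ι))) (volume : Measure (ℝ × (EuclideanSpace ℝ ι))) :=
      MeasureTheory.QuasiMeasurePreserving.prodMap hd (Measure.QuasiMeasurePreserving.id _)
    have h2 := (h1.comp_quasiMeasurePreserving hφ).indicator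
      ((measurableSet_Ioo (a := (0 : ℝ)) (b := ν * t)).prod (MeasurableSet.univ (α := EuclideanSpace ℝ ι)))
    refine h2.congr (Eventually.of_forall fun p => ?_)
    rcases p with ⟨s, y⟩
    simp only [Set.indicator_apply, Function.comp_apply, Prod.map_apply, id_eq, mem_prod, mem_univ,
      and_true, uncurry_apply_pair, hWapp]
  -- `B(W, W)(νt) = ν B^ν_0(u,u)(t)`
  have hresc : ∀ x, kochTataruBilinear W W (ν * t) x = ν • oseenDuhamel ν 0 u u t x := by
    intro x
    rw [hW, kochTataruBilinear_rescale_eq_smul_oseenDuhamel hν t x]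
    congr 1
    refine oseenDuhamel_congr_ae_slices ?_ x
    filter_upwards [ae_restrict_mem measurableSet_Ioo] with τ hτ
    rw [hut, indicator_of_mem (show τ ∈ Ioo 0 T from ⟨hτ.1, hτ.2.trans_le htT⟩)]
  have hOs : oseenDuhamel ν 0 u u t = ν⁻¹ • kochTataruBilinear W W (ν * t) := by
    funext x
    rw [Pi.smul_apply, hresc, smul_smul, inv_mul_cancel₀ hν.ne', one_smul]
  -- the Koch–Tataru-side results at time `S = νt`
  have hS : 0 < ν * t := mul_pos hν ht
  have hB2 := memLp_two_kochTataruBilinear hWm hM hWM hS hW2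
  have hQ := lintegral_hom_weight_fourier_kochTataruBilinear_le hWm hM hWM hWX hS hW2 hσ₀ hσ₁
  have hW' : AEStronglyMeasurable (uncurry W)
      ((volume : Measure (ℝ × (EuclideanSpace ℝ ι))).restrict (Ioi 0 ×ˢ univ)) := hWm.restrict
  have hBint : Integrable (kochTataruBilinear W W (ν * t)) :=
    integrable_kochTataruBilinear_slice hW' hW' (lintegral_weight_enorm_mul_enorm_lt_top hWm hS hW2).2
  set cB : (EuclideanSpace ℝ ι) → EuclideanSpace ℂ ι := complexify ∘ kochTataruBilinear W W (ν * t) with hcB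
  have hcB2 : MemLp cB 2 volume := memLp_complexify_comp hB2
  have hcB1 : Integrable cB :=
    memLp_one_iff_integrable.1 (memLp_complexify_comp (memLp_one_iff_integrable.2 hBint))
  have hcBsemi : Function.eHomSobolevSeminorm σ cB ≤
      ENNReal.ofReal (C₀ * ((ν * t) ^ ((1 - σ) / 2) / ((1 - σ) / 2)) * M) * L := by
    rw [Function.eHomSobolevSeminorm_of_memLp hcB2, FunctionSpaces.eHomSobolevSeminorm]
    have hae := FunctionSpaces.fourier_toLp_ae_eq_fourierIntegral hcB1 hcB2
    rw [lintegral_congr_ae (hae.mono fun ξ hξ => by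
      show ‖ξ‖ₑ ^ (2 * σ) * ‖((𝓕 (hcB2.toLp cB) : Lp (EuclideanSpace ℂ ι) 2
          (volume : Measure (EuclideanSpace ℝ ι))) : (EuclideanSpace ℝ ι) → EuclideanSpace ℂ ι) ξ‖ₑ ^ 2 =
        ‖ξ‖ₑ ^ (2 * σ) * ‖𝓕 cB ξ‖ₑ ^ (2 : ℕ)
      rw [hξ])]
    rw [hC₀] at *
    exact hQ
  have hcBmem : FunctionSpaces.MemHomSobolev σ cB :=
    FunctionSpaces.memHomSobolev_iff.2 ⟨hcB2, hcBsemi.trans_lt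
      (ENNReal.mul_lt_top ENNReal.ofReal_lt_top ENNReal.coe_lt_top)⟩
  -- transfer to `B^ν_0(u,u)(t) = ν⁻¹ B(W,W)(νt)`
  have hν' : ((ν⁻¹ : ℝ) : ℂ) ≠ 0 := by
    rw [Ne, Complex.ofReal_eq_zero]
    exact inv_ne_zero hν.ne'
  have hcOs : complexify ∘ oseenDuhamel ν 0 u u t = ((ν⁻¹ : ℝ) : ℂ) • cB := by
    funext x
    simp only [Function.comp_apply, hOs, Pi.smul_apply, hcB]
    rw [complexify.map_smul, Complex.coe_smul]
  refine ⟨by rw [hOs]; exact hB2.const_smul _, ?_, ?_⟩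
  · rw [hcOs]
    exact memHomSobolev_complex_smul hcBmem hν'
  · rw [hcOs]
    have hnorm : ‖((ν⁻¹ : ℝ) : ℂ)‖ₑ = ENNReal.ofReal ν⁻¹ := by
      rw [← ofReal_norm, Complex.norm_real, Real.norm_of_nonneg (inv_pos.2 hν).le]
    have hkey : ν⁻¹ * (C₀ * ((ν * t) ^ ((1 - σ) / 2) / ((1 - σ) / 2)) * M) =
        C₀ * (2 / (1 - σ)) * ν ^ (-((1 + σ) / 2)) * t ^ ((1 - σ) / 2) * M := by
      have h1 : (ν * t) ^ ((1 - σ) / 2) = ν ^ ((1 - σ) / 2) * t ^ ((1 - σ) / 2) :=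
        Real.mul_rpow hν.le ht.le
      have h2 : ν ^ (-((1 + σ) / 2)) = ν⁻¹ * ν ^ ((1 - σ) / 2) := by
        rw [← Real.rpow_neg_one ν, ← Real.rpow_add hν]
        congr 1
        ring
      have h3 : (1 - σ) / 2 ≠ 0 := by
        have : 0 < 1 - σ := by linarith
        positivity
      rw [h1, h2]
      field_simp
    calc Function.eHomSobolevSeminorm σ (((ν⁻¹ : ℝ) : ℂ) • cB)
        ≤ ‖((ν⁻¹ : ℝ) : ℂ)‖ₑ * Function.eHomSobolevSeminorm σ cB :=
          eHomSobolevSeminorm_complex_smul_le σ hν' cB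
      _ ≤ ENNReal.ofReal ν⁻¹ * (ENNReal.ofReal (C₀ * ((ν * t) ^ ((1 - σ) / 2) / ((1 - σ) / 2)) * M) * L) := by
          rw [hnorm]
          exact mul_le_mul' le_rfl hcBsemi
      _ = ENNReal.ofReal (C₀ * (2 / (1 - σ)) * ν ^ (-((1 + σ) / 2)) * t ^ ((1 - σ) / 2) * M) * L := by
          rw [← mul_assoc, ← ENNReal.ofReal_mul (inv_pos.2 hν).le, hkey]

end Oseen

end Literature.Analysis.FluidPDE
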